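import Literature.Probability.LatticeModels.LayeredPlaneRotatorIsingCertificate
import Literature.Probability.LatticeModels.IsingSusceptibilityFromToeplitz
import HarnessLib

/-!
# Layer decoupling of the classical layered XY model with the single-layer susceptibility certified by the
# exact planar-Ising row correlations (Toeplitz determinants of Onsager's symbol)

The layer-decoupling theorem of the tree (`PlaneRotator.twoPoint_layered_le_pow_interlayer'`, E. H. Lieb, Comm. Math.
Phys. **77** (1980) 127 [Lieb1980] eq. (23) / V. Rivasseau 1980, proved): for the classical layered XY model on a finite
`Λ ⊂ ℤ³` (in-plane `J∥`, stacking `J⊥`), `⟨cos(θ_a − θ_c)⟩_Λ ≤ (βJ⊥χ)^{|ℓ(a) − ℓ(c)|}` for ANY `χ` bounding the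
single-layer susceptibilities. `LayeredPlaneRotatorIsingCertificate.lean` supplied `χ = (2K+1)²/(1 − φ_{β₀'}(S₀))` from one
exact Duminil-Copin–Tassion box of the 2D Ising model at `β₀' ≥ βJ∥/2` (Aizenman–Simon's rotor ≤ Ising comparison,
[AizenmanSimon1980RotorIsing] eq. (1), a kernel theorem) — a route whose `(2K+1)²` prefactor stops at
`k_BT ≈ 1.25·J∥` for cuprate anisotropies. This file feeds instead the susceptibility ceiling of
`IsingSusceptibilityFromToeplitz.lean`, read off the EXACT solution:

  `χ^{Is}(β₀') ≤ X_T := (1 + A)/(1 − 32L·tanh β₀'·dL)`,  `A ≥ ∑_{k<L} 8(k+1)·Re D_{k+1}(φ_{β₀'})`,  `dL ≥ Re D_L(φ_{β₀'})`,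

`D_k(φ_β)` the `k × k` Toeplitz determinant of Onsager's symbol (= the row correlation `(σ_{00}σ_{0k})_p(β)`, Montroll–
Potts–Ward [MontrollPottsWard1963]; tree `torusRowPairLimit_eq_toeplitzDet`). The two numbers `A`, `dL` are certifiable
by interval arithmetic for `β₀'` up to `≈ 0.435` (`β_c(2) = 0.4407`), `L` a few correlation lengths.

* §1 `sum_twoPoint_inPlane_le_of_toeplitz` — the single-layer susceptibility of the layered XY model (any finite
  `Λ ⊂ ℤ³`, any site) is `≤ X_T` whenever `βJ∥/2 ≤ β₀' < β_c(2)` (Aizenman–Simon × GKS volume monotonicity ×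
  `sum_isingTwoPoint_free_le_of_toeplitz`).
* §2 **`twoPoint_layered_le_pow_of_toeplitz`** — `⟨cos(θ_a − θ_c)⟩_{Λ,β} ≤ (βJ⊥·X_T)^{|ℓ(a) − ℓ(c)|}`: geometric decay
  across the layers, uniformly in the volume, as soon as `βJ⊥·X_T < 1`.

Reading (cell `pub/hubbard-tc`, MO-S3, seat mod-1, ASSUMPTIONS §1 key K4-c / route K5-I): with the certified values of
kit j287898 (Arb balls; `β₀' = 0.43`, `L = 240`: `A ≤ 823.556`, `Re D₂₄₀ ≤ 2.3823·10⁻⁶`, so `X_T ≤ 831`) the layered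
comparison model has no order across the layers at `k_BT = J∥/(2β₀') = 1.163·J∥` for every anisotropy
`J⊥/J∥ ≤ 1/(2β₀' X_T) = 1.39·10⁻³` — within `3 %` of the Aizenman–Simon–Onsager window `J∥/ln(1+√2) = 1.1346·J∥`
(`LayeredPlaneRotatorOnsagerWindow.lean`, where the threshold is existential). Classical effective model only (K5); no
`T_c` object; the numerics of `D_k` are not here (hypotheses `hA`, `hdL`).
-/

noncomputable section

open MeasureTheory Filter Finset
open scoped Topology BigOperators

namespace Literature.Probability.LatticeModels

namespace PlaneRotator

section ToeplitzCertificate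

open Literature.Barriers.CriticalPhenomena Literature.Barriers.CriticalPhenomena.LongRangeIsing
open Literature.Analysis.Toeplitz

variable {Λ : Finset (Site 3)} {k : ℤ}

/-- `layer x` is the last coordinate. [folklore] -/
private theorem layer_eq_apply_last' (x : Λ) : layer x = (x : Site 3) (Fin.last 2) := rfl

/-- The lifted site lies in layer `k`. [folklore] -/
private theorem layer_layerEmb' (z : ↥(layerSites Λ k)) : layer (layerEmb Λ k z) = k := by
  rw [layer_eq_apply_last']
  show (Fin.snoc z.1 k : Site 3) (Fin.last 2) = k
  exact Fin.snoc_last _ _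

/-- Projecting the lifted site gives back the projected site. [folklore] -/
private theorem init_layerEmb' (z : ↥(layerSites Λ k)) : Fin.init ((layerEmb Λ k z : Λ) : Site 3) = z.1 :=
  Fin.init_snoc _ _

/-- The layer embedding is injective. [folklore] -/
private theorem layerEmb_injective' : Function.Injective (layerEmb Λ k) := by
  intro z w h
  apply Subtype.ext
  have := congrArg (fun x : Λ => Fin.init (x : Site 3)) h
  simpa only [init_layerEmb'] using this

/-- A site of layer `k` projects into `layerSites Λ k`. [folklore] -/
private theorem init_mem_layerSites' {x : Λ} (hx : layer x = k) : Fin.init (x : Site 3) ∈ layerSites Λ k :=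
  Finset.mem_image.2 ⟨x, Finset.mem_filter.2 ⟨x.2, hx⟩, rfl⟩

/-- Lifting the projection of a layer-`k` site gives the site back. [folklore] -/
private theorem layerEmb_init' {x : Λ} (hx : layer x = k) :
    layerEmb Λ k ⟨Fin.init (x : Site 3), init_mem_layerSites' hx⟩ = x := by
  apply Subtype.ext
  show (Fin.snoc (Fin.init (x : Site 3)) k : Site 3) = x
  rw [← hx, layer_eq_apply_last']
  exact Fin.snoc_init_self _

/-- Layer `k` of `Λ`, as a finset of `Λ`, is the image of the layer embedding. [folklore] -/
private theorem filter_layer_eq_image_layerEmb' (k : ℤ) :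
    univ.filter (fun x : Λ => layer x = k) = univ.image (layerEmb Λ k) := by
  ext x
  simp only [Finset.mem_filter, Finset.mem_univ, true_and, Finset.mem_image]
  constructor
  · intro hx; exact ⟨_, layerEmb_init' hx⟩
  · rintro ⟨z, rfl⟩; exact layer_layerEmb' z

variable {β Jp Jz : ℝ}
variable [MeasurableSpace Circle] [BorelSpace Circle]

/-! ### §1 The single-layer susceptibility of the layered XY model from the Toeplitz data -/

/-- **Single-layer susceptibility of the layered XY model from the exact planar-Ising row correlations** (Aizenman–Simon
× GKS volume monotonicity × `sum_isingTwoPoint_free_le_of_toeplitz`): for `β, J∥ > 0`, `J⊥ ≥ 0`, every finite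
`Λ ⊂ ℤ³`, every `a ∈ Λ`, an Ising coupling `β₀'` with `βJ∥/2 ≤ β₀' < β_c(2)`, `L ≥ 1` and numbers
`A ≥ ∑_{k<L} 8(k+1)·Re D_{k+1}(φ_{β₀'})`, `dL ≥ Re D_L(φ_{β₀'})` with `32L·tanh β₀'·dL < 1`:
`∑_{x ∈ Λ_{ℓ(a)}} ⟨cos(θ_a − θ_x)⟩^{2D}_{Λ_{ℓ(a)}} ≤ (1 + A)/(1 − 32L·tanh β₀'·dL)` — hypothesis `hχ` of
`twoPoint_layered_le_pow_interlayer'`. [cite: AizenmanSimon1980RotorIsing, eq. (1)] [cite: DeiftItsKrasovsky2013, §4, eq. (50)] -/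
theorem sum_twoPoint_inPlane_le_of_toeplitz (hβ : 0 < β) (hp : 0 < Jp) (hz : 0 ≤ Jz) (Λ : Finset (Site 3))
    {β₀' : ℝ} (hβ' : β * Jp / 2 ≤ β₀') (hβ₀c : β₀' < criticalBetaTwo) {L : ℕ} (hL : 1 ≤ L) {A dL : ℝ}
    (hA : ∑ k ∈ Finset.range L,
        8 * ((k : ℝ) + 1) * (toeplitzDet (circleCoeff (onsagerSymbol β₀')) (k + 1)).re ≤ A)
    (hdL : (toeplitzDet (circleCoeff (onsagerSymbol β₀')) L).re ≤ dL)
    (hφ : 32 * L * Real.tanh β₀' * dL < 1) (a : Λ) :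
    ∑ x ∈ univ.filter (fun x : Λ => layer x = layer a),
        twoPoint (inPlane (layeredXYCoupling β Jp Jz Λ) (layer a)) a x ≤
      (1 + A) / (1 - 32 * L * Real.tanh β₀' * dL) := by
  classical
  set k := layer a with hk
  have hβ'' : 0 < β * Jp / 2 := by positivity
  rw [filter_layer_eq_image_layerEmb' k, Finset.sum_image fun z _ w _ h => layerEmb_injective' h]
  calc ∑ z : ↥(layerSites Λ k), twoPoint (inPlane (layeredXYCoupling β Jp Jz Λ) k) a (layerEmb Λ k z)
      ≤ ∑ z : ↥(layerSites Λ k), isingTwoPoint (zdGraph 2) (layerSites Λ k) (β * Jp / 2) 0 .free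
          (Fin.init (a : Site 3)) z.1 := by
        refine Finset.sum_le_sum fun z _ => ?_
        have h := twoPoint_inPlane_le_isingTwoPoint hβ.le hp.le hz Λ a (layerEmb Λ k z) rfl (layer_layerEmb' z)
        rwa [init_layerEmb'] at h
    _ = ∑ v ∈ layerSites Λ k, isingTwoPoint (zdGraph 2) (layerSites Λ k) (β * Jp / 2) 0 .free
          (Fin.init (a : Site 3)) v :=
        Finset.sum_coe_sort (layerSites Λ k) (fun v => isingTwoPoint (zdGraph 2) (layerSites Λ k) (β * Jp / 2) 0 .free
          (Fin.init (a : Site 3)) v)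
    _ ≤ (1 + A) / (1 - 32 * L * Real.tanh β₀' * dL) :=
        sum_isingTwoPoint_free_le_of_toeplitz hβ'' hβ' hβ₀c hL hA hdL hφ (layerSites Λ k) (init_mem_layerSites' rfl)

/-! ### §2 The certificate-backed layer decoupling -/

/-- **Layer decoupling of the classical layered XY model from the exact planar-Ising row correlations** — kernel end
to end (Lieb–Rivasseau decoupling, Aizenman–Simon comparison, GKS, Messager–Miracle-Solé, the Duminil-Copin–Tassion box
iteration and the Toeplitz form of the exact solution, all theorems of the tree), the only external inputs being the
two numbers `A ≥ ∑_{k<L} 8(k+1)·Re D_{k+1}(φ_{β₀'})` and `dL ≥ Re D_L(φ_{β₀'})` (finite determinants of Fourier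
coefficients of Onsager's symbol; interval arithmetic): for `β, J∥ > 0`, `J⊥ ≥ 0`, `βJ∥/2 ≤ β₀' < β_c(2)`, `L ≥ 1`,
`32L·tanh β₀'·dL < 1`, every finite `Λ ⊂ ℤ³` and all `a, c ∈ Λ`,

  `⟨cos(θ_a − θ_c)⟩_{Λ,β} ≤ (β J⊥ · (1 + A)/(1 − 32L·tanh β₀'·dL))^{|ℓ(a) − ℓ(c)|}`.

Reading (K4-c): no order across the layers at `k_BT = 1/β` whenever `βJ⊥·X_T < 1`; with `βJ∥ = 2β₀'` this is the
anisotropy condition `J⊥/J∥ ≤ 1/(2β₀'·X_T)`. [cite: Lieb1980, eq. (23) and notes added in proof (2)]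
[cite: AizenmanSimon1980RotorIsing, eq. (1)] [cite: DeiftItsKrasovsky2013, §4, eq. (50)] -/
theorem twoPoint_layered_le_pow_of_toeplitz (hβ : 0 < β) (hp : 0 < Jp) (hz : 0 ≤ Jz) (Λ : Finset (Site 3))
    {β₀' : ℝ} (hβ' : β * Jp / 2 ≤ β₀') (hβ₀c : β₀' < criticalBetaTwo) {L : ℕ} (hL : 1 ≤ L) {A dL : ℝ}
    (hA : ∑ k ∈ Finset.range L,
        8 * ((k : ℝ) + 1) * (toeplitzDet (circleCoeff (onsagerSymbol β₀')) (k + 1)).re ≤ A)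
    (hdL : (toeplitzDet (circleCoeff (onsagerSymbol β₀')) L).re ≤ dL)
    (hφ : 32 * L * Real.tanh β₀' * dL < 1) (a c : Λ) :
    twoPoint (layeredXYCoupling β Jp Jz Λ) a c ≤
      (β * Jz * ((1 + A) / (1 - 32 * L * Real.tanh β₀' * dL))) ^ (layer a - layer c).natAbs :=
  twoPoint_layered_le_pow_interlayer' hβ.le hp.le hz Λ
    (fun a => sum_twoPoint_inPlane_le_of_toeplitz hβ hp hz Λ hβ' hβ₀c hL hA hdL hφ a) a c

/-- The same with the base replaced by any larger number `r` (the form in which a certified smallness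
`βJ⊥·X_T ≤ r < 1` is consumed): `⟨cos(θ_a − θ_c)⟩_{Λ,β} ≤ r^{|ℓ(a) − ℓ(c)|}`.
[cite: Lieb1980, eq. (23) and notes added in proof (2)] [cite: DeiftItsKrasovsky2013, §4, eq. (50)] -/
theorem twoPoint_layered_le_pow_of_toeplitz_le (hβ : 0 < β) (hp : 0 < Jp) (hz : 0 ≤ Jz) (Λ : Finset (Site 3))
    {β₀' : ℝ} (hβ' : β * Jp / 2 ≤ β₀') (hβ₀c : β₀' < criticalBetaTwo) {L : ℕ} (hL : 1 ≤ L) {A dL : ℝ}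
    (hA : ∑ k ∈ Finset.range L,
        8 * ((k : ℝ) + 1) * (toeplitzDet (circleCoeff (onsagerSymbol β₀')) (k + 1)).re ≤ A)
    (hdL : (toeplitzDet (circleCoeff (onsagerSymbol β₀')) L).re ≤ dL)
    (hφ : 32 * L * Real.tanh β₀' * dL < 1) {r : ℝ}
    (hr : β * Jz * ((1 + A) / (1 - 32 * L * Real.tanh β₀' * dL)) ≤ r) (a c : Λ) :
    twoPoint (layeredXYCoupling β Jp Jz Λ) a c ≤ r ^ (layer a - layer c).natAbs := by
  have hA0 : 0 ≤ A := by
    refine le_trans (Finset.sum_nonneg fun k _ => ?_) hA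
    have hβ₀ : 0 < β₀' := (by positivity : 0 < β * Jp / 2).trans_le hβ'
    have h := torusRowPairLimit_nonneg hβ₀.le (k + 1)
    rw [torusRowPairLimit_eq_re_toeplitzDet hβ₀ hβ₀c.ne] at h
    positivity
  have hbase : 0 ≤ β * Jz * ((1 + A) / (1 - 32 * L * Real.tanh β₀' * dL)) :=
    mul_nonneg (mul_nonneg hβ.le hz) (div_nonneg (by linarith) (sub_pos.2 hφ).le)
  exact (twoPoint_layered_le_pow_of_toeplitz hβ hp hz Λ hβ' hβ₀c hL hA hdL hφ a c).trans
    (pow_le_pow_left₀ hbase hr _)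

end ToeplitzCertificate

end PlaneRotator

end Literature.Probability.LatticeModels
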